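import Summits.CriticalPhenomena.SAWScalingLimit.Theses.SAWTwistedSelfEnergy
import Summits.CriticalPhenomena.SAWScalingLimit.Theorems.SAWRenewalTightnessEventualTightOfVirginArc
import HarnessLib

/-!
# Split glue for the bet route's copy of the crux: `ConfinementPositivity → VirginArcTraversalTight → SAWTwistedSelfEnergy.EventualTight`

Registered stub `EventualTightTSE_of_subs` of the crux item stmt-CriticalPhenomena-1881 (filed by crux-strategist b1 on the bet
route `SAWTwistedSelfEnergy`, 2026-08-17T08:49Z; Theorems/ is prover-only, so the strategist's kernel-checked file could not be
landed by that seat).  The two hypotheses are, verbatim, the bodies of the family's two research leaves: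

* E = restriction positivity `ConfinementPositivity` (item stmt-CriticalPhenomena-17587): for nested Dobrushin domains `D' ⊆ D`
  agreeing near the marked points, the critical SAW law of `D` gives the walks confined to `D'` mass `≥ c > 0` eventually;
* X2c₁ = the virgin-arc traversal count atom `VirginArcTraversalTight` (item stmt-CriticalPhenomena-17940): for a lattice disc
  `Λ ⊇ B(z₀, N) ∩ ℤ²` with an arbitrary exterior graph `H ≤ ℤ²` complete near the disc, the `x_c`-weighted mass of door-to-door
  self-avoiding arcs making `k` separate traversals of `D(z₀; 2N/5, 3N/5)` is `≤ θ ×` the total arc mass, uniformly in `N ≥ N₀`.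

Composition (no content of its own): the landed set-form theorem
`Theorems.eventualTight_of_virginArcTraversalTight_of_confinementPositivity : X2c₁ → E → SAWRenewalTightness.EventualTight`
(virginization + aspect reduction + split glue + Aizenman–Burchard criterion, all in tree) followed by the Literature bridge
`isTightAlongMesh_of_isTightMeasureSet_image` (a tight image of `(0, δ₀]` is tight along `𝓝[>] 0`; the SAW observable is measurable
for the discrete σ-algebra).  With this file in the tree the route-level split of stmt-1881 on `route-CriticalPhenomena-SAWTwistedSelfEnergy`
into the existing items stmt-17587 / stmt-17940 can cite `--glue-by` this declaration (strategist b1's staged `children.json`).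

References: Aizenman–Burchard, Duke Math. J. 99 (1999), Thm 1.1 (tightness from traversal-count bounds); Kemppainen–Smirnov,
Ann. Probab. 45 (2017), §2–3 (one-scale crossing conditions); Duminil-Copin–Smirnov, Ann. of Math. 175 (2012), §4 (the critical
SAW law of a discrete domain).
-/

noncomputable section

open MeasureTheory Filter Topology Set Metric
open scoped ENNReal NNReal unitInterval
open Literature.Probability.RandomPlanarGeometry Literature.Probability.LatticeModels

namespace Summit.CriticalPhenomena.SAWScalingLimit.Theorems.SAWTwistedSelfEnergySplit

/-- **Split glue (registered stub `EventualTightTSE_of_subs`)**: restriction positivity E (= item stmt-17587) and the virgin-arc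
traversal count atom X2c₁ (= item stmt-17940) imply the bet route's along-the-mesh crux `SAWTwistedSelfEnergy.EventualTight`, by the
landed set-form composition `eventualTight_of_virginArcTraversalTight_of_confinementPositivity` and the bridge
`isTightAlongMesh_of_isTightMeasureSet_image`. [cite: AizenmanBurchardDuke1999, Thm 1.1] -/
theorem EventualTightTSE_of_subs : (∀ (D D' : DobrushinDomain) (a b : ℝ → Site 2) (d : ℝ), 0 < d → D'.carrier ⊆ D.carrier → D'.pt 0 = D.pt 0 → D'.pt 1 = D.pt 1 → D.carrier ∩ (Metric.ball (D.pt 0) d ∪ Metric.ball (D.pt 1) d) ⊆ D'.carrier → SAW.IsEndpointApprox D' a b → ∃ c δ₀ : ℝ, 0 < c ∧ 0 < δ₀ ∧ ∀ δ ∈ Set.Ioc (0 : ℝ) δ₀, ENNReal.ofReal c ≤ SAW.law D.carrier δ (a δ) (b δ) {γ | ∃ γ' : SAW.DomainSAW D'.carrier δ (a δ) (b δ), γ'.walk.support = γ.walk.support}) → (∀ θ : ℝ, 0 < θ → ∃ (k : ℕ) (N₀ : ℝ), 0 < N₀ ∧ ∀ (H : SimpleGraph (Site 2)) (Λ : Set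 (Site 2)) (z₀ : ℂ) (N : ℝ) (u c u' c' : Site 2), N₀ ≤ N → (H ≤ zdGraph 2 ∧ (∀ v : Site 2, dist (Site.toComplex v) z₀ ≤ N → v ∈ Λ) ∧ ∀ v v' : Site 2, dist (Site.toComplex v) z₀ ≤ N + 1 → dist (Site.toComplex v') z₀ ≤ N + 1 → (zdGraph 2).Adj v v' → H.Adj v v') → (H.Adj u c ∧ u ∉ Λ ∧ c ∈ Λ ∧ dist (Site.toComplex c) z₀ ≤ N ∧ N < dist (Site.toComplex u) z₀) → (H.Adj u' c' ∧ u' ∉ Λ ∧ c' ∈ Λ ∧ dist (Site.toComplex c') z₀ ≤ N ∧ N < dist (Site.toComplex u') z₀) → ∑' p : {p : {p : H.Walk c c' // p.IsPath ∧ ∀ v ∈ p.support, v ∈ Λ} // ∃ ι κ : Fin k → Fin (p.1.support.map Site.toComplex).length, (∀ m, ι m ≤ κ m) ∧ (∀ m, (dist ((p.1.support.map Site.toComplex).get (ι m)) z₀ ≤ 2 * N / 5 ∧ 3 * N / 5 ≤ dist ((p.1.support.map Site.toComplex).get (κ m)) z₀) ∨ (3 * N / 5 ≤ dist ((p.1.support.map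 Site.toComplex).get (ι m)) z₀ ∧ dist ((p.1.support.map Site.toComplex).get (κ m)) z₀ ≤ 2 * N / 5)) ∧ ∀ ⦃m m'⦄, m < m' → κ m ≤ ι m'}, ENNReal.ofReal (SAW.criticalFugacity ^ p.1.1.length) ≤ ENNReal.ofReal θ * ∑' p : {p : H.Walk c c' // p.IsPath ∧ ∀ v ∈ p.support, v ∈ Λ}, ENNReal.ofReal (SAW.criticalFugacity ^ p.1.length)) → Summit.CriticalPhenomena.SAWScalingLimit.Theses.SAWTwistedSelfEnergy.EventualTight := by
  intro hE hX D a b hab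
  obtain ⟨δ₀, hδ₀, hT⟩ :=
    Summit.CriticalPhenomena.SAWScalingLimit.Theorems.eventualTight_of_virginArcTraversalTight_of_confinementPositivity
      hX hE D a b hab
  exact isTightAlongMesh_of_isTightMeasureSet_image
    (Eventually.of_forall fun δ => (SAW.DomainSAW.measurable_of_top _).aemeasurable) hδ₀ hT

end Summit.CriticalPhenomena.SAWScalingLimit.Theorems.SAWTwistedSelfEnergySplit

end
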